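import Literature.IUT.LogThetaLattice.UnitMuCoricOfThetaMonoids
import Literature.IUT.LogThetaLattice.HodgeTheaterLogLink

/-!
# [IUTchII] Cor 4.10 (iv) / [IUTchIII] Thm 1.5 (ii) / Thm 2.2 (i): ONE frame-level residual (bridge)

Proof-only bridge (abc-iut cell, wave-4 discharge seat abc-iut-w4-d028, DISCHARGE-L6 §F row F6; no new
definitions, no typer file edited). S. Mochizuki, *Inter-universal Teichmüller theory II*, kurims Dec-2020
manuscript, Cor. 4.10 (iv) p. 160; *III*, kurims May-2020 manuscript, Thm. 1.5 (ii) p. 48, Thm. 2.2 (i) p. 65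
[cite: Mochizuki2012, Cor 4.10 (iv) p.160]. Claim key `Mochizuki2012`, status DISPUTED (D-0012): bookkeeping
over interfaces; nothing here asserts a disputed claim or takes a side on [IUTchIII] Cor. 3.12.

The tree carries THREE typings of the same printed fact ([IUTchII] Cor 4.10 (iv) p.160: "“`(−)F^{⊢×μ}_△`” is an
invariant of both the `Θ^{×μ}`- and `Θ^{×μ}_{gau}`-links"), i.e. (paraphrase) the functor `F^{⊩▶×μ} ↦ F^{⊢×μ}` of
[IUTchII] Def 4.9 (vi)–(viii) carries full poly-isomorphisms ONTO full poly-isomorphisms: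

| printed item | tree decl | shape |
|---|---|---|
| [IUTchII] Cor 4.10 (iv) p.160 | `HodgeTheaterStrips.UnitMuCoric` (abc-iut-L6-t2, `ThetaGauLinks`; FACT-LIST F-2065) | named `Prop`, reduced to iso-surjectivity by `unitMuCoric_of_mapIso_surjective` |
| [IUTchIII] Thm 1.5 (ii) p.48 | field `ThetaLinkData.induced_full` (abc-iut-L6-t3, `HodgeTheaterLogLink`) | interface axiom: `(full).map S.FglxmToFxm = full` between the pilots |
| [IUTchIII] Thm 2.2 (i) p.65 "the second arrows in each line are surjections" | field `ThetaMonoidData.mapAut_surjective` (abc-iut-L6-t3, `ThetaMonoids`) | interface axiom: `Aut_{F^{⊩▶×μ}}(X) ↠ Aut_{F^{⊢×μ}}(X)` |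

abc-iut-L6-d1's `UnitMuCoricOfThetaMonoids` proved Thm 2.2 (i) ⇒ frame-level fullness ⇒ Cor 4.10 (iv). This file
closes the circle, so that the Cor 3.12 cone names ONE residual — the frame-level property
`R(S) :≡ ∀ X Y : S.Fglxm, (PolyIso.full X Y).map S.FglxmToFxm = PolyIso.full _ _`:

* `mapIso_surjective_of_iso` — iso-surjectivity of a functor on `Isom(A, B)` transports along `A ≅ A'`,
  `B ≅ B'` (pure category theory);
* `map_full_fglxmToFxm_of_thetaLinkData` — any inhabitant of `ThetaLinkData S` together with ONE Hodge
  theater gives `R(S)` (the axiom `induced_full` at one pair of pilots, transported along the connectedness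
  `StripFrame.iso_nonempty_Fglxm` of [IUTchII] Def 4.9 (viii));
* hence `unitMuCoric_all_of_thetaLinkData` (**IUTchII:Cor4.10(iv)** for EVERY pair of Hodge-theater strips over
  the frame-induced setting, no identification with the pilots needed; v2: renamed from `unitMuCoric_of_thetaLinkData`,
  which abc-iut-w4-d017's `BiCoresProofs` p411664 declares for strips identified with the pilots — FQN-collision repair) and `mapAut_surjective_of_thetaLinkData` (the **IUTchIII:Thm2.2(i)** field shape);
* conversely `induced_full_of_map_full` / `induced_full_of_thetaMonoidData`: `R(S)` (resp. Thm 2.2 (i) as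
  typed) yields the `induced_full` field shape for ANY pair of pilot functors, and
  `linkInducedFxm_full_iff_mapIso_surjective` records that abc-iut-L6-t3's Thm 1.5 (ii) conclusion at a pair
  of Hodge theaters is literally the iso-surjectivity hypothesis of abc-iut-L6-t2's reduction.

What `R(S)` is for the REAL strip categories is recorded in `HodgeArakelov/LocalTriMuDataIsoSurjectivityWitness`
(finding W4D028-F1: formal for print's direct-product objects `O^▶ × O^{×μ}` of Def 4.9 (iii)/(iv); NOT formal
for the typed `O^▷`-level morphisms — plan/GAP-LEDGER.md row G-w4d028-1). Typed ≠ discharged.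
-/

namespace Literature.IUT.LogThetaLattice

open CategoryTheory
open Literature.IUT.HodgeTheaters (PolyIso)
open Literature.IUT.HodgeArakelov

universe v u v' u'

/-! ### Transport of iso-surjectivity along isomorphisms -/

section Categorical

variable {C : Type u} [Category.{v} C] {D : Type u'} [Category.{v'} D]

/-- If a functor `Φ` is surjective on `Isom(A, B)` and `A ≅ A'`, `B ≅ B'`, then `Φ` is surjective on
`Isom(A', B')` (conjugate, lift, conjugate back) — the step that lets ONE instance of [IUTchII] Cor 4.10 (iv)
p.160 propagate to all `F^{⊩▶×μ}`-prime-strips, any two being isomorphic ([IUTchII] Def 4.9 (viii)).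
[cite: Mochizuki2012, Cor 4.10 (iv) p.160] -/
theorem mapIso_surjective_of_iso (Φ : C ⥤ D) {A B A' B' : C} (α : A ≅ A') (β : B ≅ B')
    (h : Function.Surjective (Φ.mapIso : (A ≅ B) → (Φ.obj A ≅ Φ.obj B))) :
    Function.Surjective (Φ.mapIso : (A' ≅ B') → (Φ.obj A' ≅ Φ.obj B')) := by
  intro φ
  obtain ⟨f, hf⟩ := h (Φ.mapIso α ≪≫ φ ≪≫ (Φ.mapIso β).symm)
  refine ⟨α.symm ≪≫ f ≪≫ β, ?_⟩
  rw [Functor.mapIso_trans, Functor.mapIso_trans, hf, Functor.mapIso_symm]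
  ext
  simp

end Categorical

/-! ### The one residual over a strip frame -/

section Frame

variable {S : StripFrame.{u}}

/-- **IUTchIII:Thm1.5(ii)** (kurims p.48) ⟹ the frame-level residual: ANY inhabitant of abc-iut-L6-t3's
`ThetaLinkData S` (whose field `induced_full` is Thm 1.5 (ii) / [IUTchII] Cor 4.10 (iv) at the pilots of two
Hodge theaters), together with one Hodge theater, makes `F^{⊩▶×μ} ↦ F^{⊢×μ}` carry the full poly-isomorphism
between ANY two `F^{⊩▶×μ}`-prime-strips onto the full poly-isomorphism (transport along
`StripFrame.iso_nonempty_Fglxm`, [IUTchII] Def 4.9 (viii)). [claim: Mochizuki2012, status: disputed] -/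
theorem map_full_fglxmToFxm_of_thetaLinkData (T : ThetaLinkData S) (H : S.HT) (X Y : S.Fglxm) :
    (PolyIso.full X Y).map S.FglxmToFxm = PolyIso.full _ _ := by
  have h0 := (mapIso_surjective_iff_map_full S.FglxmToFxm _ _).mpr
    (T.induced_full LatticeKind.gaussian H H)
  exact (mapIso_surjective_iff_map_full S.FglxmToFxm X Y).mp
    (mapIso_surjective_of_iso S.FglxmToFxm
      (S.iso_nonempty_Fglxm _ X).some (S.iso_nonempty_Fglxm _ Y).some h0)

/-- **IUTchII:Cor4.10(iv)** (kurims p.160) "`(−)F^{⊢×μ}_△` is an invariant of both the `Θ^{×μ}`- and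
`Θ^{×μ}_{gau}`-links" — abc-iut-L6-t2's named statement `HodgeTheaterStrips.UnitMuCoric` (FACT-LIST F-2065) —
HOLDS for every pair of Hodge-theater strips over the frame-induced setting as soon as abc-iut-L6-t3's
[IUTchIII] Thm 1.5 (ii) interface `ThetaLinkData S` is inhabited and one Hodge theater exists: DISCHARGED
MODULO that typed interface (the companion of abc-iut-L6-d1's `unitMuCoric_of_thetaMonoidData`, which
discharges it modulo Thm 2.2 (i)). [claim: Mochizuki2012, status: disputed] -/
theorem unitMuCoric_all_of_thetaLinkData (T : ThetaLinkData S) (H : S.HT)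
    (dag ddag : HodgeTheaterStrips (ThetaLinkSetting.ofStripFrame S)) : dag.UnitMuCoric ddag :=
  dag.unitMuCoric_of_map_full ddag (map_full_fglxmToFxm_of_thetaLinkData T H)

/-- **IUTchIII:Thm2.2(i)** (kurims p.65) "the second arrows in each line are surjections"
(`Aut_{F^{⊩▶×μ}}(−) ↠ Aut_{F^{⊢×μ}}(−)`, the field `ThetaMonoidData.mapAut_surjective`) FOLLOWS, for every
`F^{⊩▶×μ}`-prime-strip, from any inhabitant of the Thm 1.5 (ii) interface `ThetaLinkData S` plus one Hodge
theater — i.e. the Thm 2.2 (i) field and the Thm 1.5 (ii) field are the same residual.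
[claim: Mochizuki2012, status: disputed] -/
theorem mapAut_surjective_of_thetaLinkData (T : ThetaLinkData S) (H : S.HT) (X : S.Fglxm) :
    Function.Surjective (S.FglxmToFxm.mapAut X) :=
  mapAut_surjective_of_mapIso_surjective S.FglxmToFxm
    ((mapIso_surjective_iff_map_full S.FglxmToFxm X X).mpr (map_full_fglxmToFxm_of_thetaLinkData T H X X))

/-- **IUTchIII:Thm1.5(ii)** (kurims p.48) conversely, the frame-level residual yields the `induced_full` field
shape of `ThetaLinkData` for ANY pair of pilot functors `†HT ↦ †F^{⊩▶×μ}_{env/gau}`, `‡HT ↦ ‡F^{⊩▶×μ}_△`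
([IUTchII] Cor 4.10 (ii)/(i)) — so a `ThetaLinkData` can be assembled from Cor 4.10 (i)–(iii) data plus the
residual alone. [claim: Mochizuki2012, status: disputed] -/
theorem induced_full_of_map_full
    (h : ∀ X Y : S.Fglxm, (PolyIso.full X Y).map S.FglxmToFxm = PolyIso.full _ _)
    (P Q : S.HT ⥤ S.Fglxm) (X Y : S.HT) :
    (PolyIso.full (P.obj X) (Q.obj Y)).map S.FglxmToFxm = PolyIso.full _ _ :=
  h _ _

/-- **IUTchIII:Thm1.5(ii)** (kurims p.48) … in particular from abc-iut-L6-t3's [IUTchIII] Prop 2.1 / Thm 2.2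
data `ThetaMonoidData S` (field `mapAut_surjective` = Thm 2.2 (i)), via abc-iut-L6-d1's
`map_full_fglxmToFxm`: the Thm 1.5 (ii) field shape for any pilots. [claim: Mochizuki2012, status: disputed] -/
theorem induced_full_of_thetaMonoidData (TM : ThetaMonoidData S) (P Q : S.HT ⥤ S.Fglxm) (X Y : S.HT) :
    (PolyIso.full (P.obj X) (Q.obj Y)).map S.FglxmToFxm = PolyIso.full _ _ :=
  map_full_fglxmToFxm TM _ _

/-- **IUTchIII:Thm1.5(ii)** (kurims p.48) abc-iut-L6-t3's Thm 1.5 (ii) conclusion at a pair of Hodge theaters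
("The horizontal arrows of the Gaussian log-theta-lattice induce full poly-isomorphisms between the respective
associated `F^{⊢×μ}`-prime-strips […]", p.48,
`ThetaLinkData.linkInducedFxm k X Y = PolyIso.full`) is EQUIVALENT to abc-iut-L6-t2's reduction hypothesis
for [IUTchII] Cor 4.10 (iv) (`unitMuCoric_of_mapIso_surjective`): surjectivity of `F^{⊩▶×μ} ↦ F^{⊢×μ}` on
`Isom(†F^{⊩▶×μ}_{env/gau}, ‡F^{⊩▶×μ}_△)`. (Both hold for every `T`, by `linkInducedFxm_full`; the equivalence
is the point.) [claim: Mochizuki2012, status: disputed] -/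
theorem linkInducedFxm_full_iff_mapIso_surjective (T : ThetaLinkData S) (k : LatticeKind) (X Y : S.HT) :
    T.linkInducedFxm k X Y = PolyIso.full _ _ ↔
      Function.Surjective
        (S.FglxmToFxm.mapIso : ((T.pilotTheta k).obj X ≅ T.pilotDelta.obj Y) → _) :=
  iff_of_true (T.linkInducedFxm_full k X Y)
    ((mapIso_surjective_iff_map_full S.FglxmToFxm _ _).mpr (T.induced_full k X Y))

/-- **IUTchII:Cor4.10(iv)** (kurims p.160) SUMMARY EQUIVALENCE over a strip frame with a Hodge theater: the
frame-level residual `R(S)` («`F^{⊩▶×μ} ↦ F^{⊢×μ}` carries full poly-isomorphisms onto full ones») is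
equivalent to the [IUTchIII] Thm 2.2 (i) field shape («`Aut_{F^{⊩▶×μ}}(X) ↠ Aut_{F^{⊢×μ}}(X)` for all `X`»), and
either one yields [IUTchII] Cor 4.10 (iv) `UnitMuCoric` for all pairs (`HodgeTheaterStrips.unitMuCoric_of_map_full`)
and the [IUTchIII] Thm 1.5 (ii) field shape for all pilots (`induced_full_of_map_full`). [claim: Mochizuki2012, status: disputed] -/
theorem map_full_iff_mapAut_surjective :
    (∀ X Y : S.Fglxm, (PolyIso.full X Y).map S.FglxmToFxm = PolyIso.full _ _) ↔
      ∀ X : S.Fglxm, Function.Surjective (S.FglxmToFxm.mapAut X) := by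
  constructor
  · intro h X
    exact mapAut_surjective_of_mapIso_surjective S.FglxmToFxm
      ((mapIso_surjective_iff_map_full S.FglxmToFxm X X).mpr (h X X))
  · intro h X Y
    exact (mapIso_surjective_iff_map_full S.FglxmToFxm X Y).mp
      (mapIso_surjective_of_mapAut_surjective S.FglxmToFxm (S.iso_nonempty_Fglxm X Y).some (h X))

end Frame

end Literature.IUT.LogThetaLattice
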